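import Summits.CriticalPhenomena.PercolationContinuityZ3.Theorems.PercNearOneGluingAdditiveGluingPairStepOdds
import HarnessLib

/-! # Crux `PercNearOneGluing.AdditiveGluing` (stmt-CriticalPhenomena-4576), line `peel`, stub `stub_toolGainIdentity` —
# the gain identity of the pair step (bookkeeping)

Support file (`--supports stmt-CriticalPhenomena-4576`); no definitions, no named facts.

`μ = prodBernoulli u` (bond percolation on `Fin n`); vertices `a₀` (the designated relay), `s` (the observer), `x` (the
bystander glued onto `s`), `b` (the target); the 2-block `S = {s, x}`.  The identity
`μ(S↔b) − μ(s↔b) − μ(a₀↮b, a₀↔S, S↔b) = μ(s↮b, a₀↮s, x↔b) − μ(s↔b, a₀↮s, x↔a₀)`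
is finite measure algebra on the events `{s↔b}, {x↔b}, {a₀↔s}, {a₀↔x}, {a₀↔b}`:
* `{S↔b} = {s↔b} ⊔ {s↮b, x↔b}` and `{s↮b, x↔b} = {s↮b, x↔b, a₀↔s} ⊔ {s↮b, a₀↮s, x↔b}`;
* the gain event `{a₀↮b} ∩ {a₀↔S} ∩ {S↔b}` is the disjoint union `{s↮b, x↔b, a₀↔s} ⊔ {s↔b, a₀↮s, x↔a₀}`
  (if `a₀↔s` then `s↮b`, hence `x↔b`; if `a₀↔x` then `x↮b`, hence `s↔b` and `a₀↮s`; conversely `a₀↔b` would force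
  `s↔b`, resp. `a₀↔s`, on the two pieces).
[cite: KozmaNitzan2024, §3.2 pp. 12–14]
-/

namespace Summit.CriticalPhenomena.PercolationContinuityZ3.Theorems

open MeasureTheory Set
open Literature.Probability.LatticeModels (prodBernoulli)
open Literature.Probability.Percolation (BondConfig openConn openConnIn openGraph openCluster)
open scoped BigOperators Classical

noncomputable section

section ToolGainIdentity

variable {n : ℕ}

/-- Membership in the event `{p ↔ q}` is reachability in the open graph. [folklore] -/
theorem toolGain_mem_openConn (p q : Fin n) (ω : BondConfig (Fin n)) :
    ω ∈ (openConn p q : Set (BondConfig (Fin n))) ↔ (openGraph ω).Reachable p q :=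
  Iff.rfl

/-- `μ(P ∪ Q) = μ(P) + μ(Pᶜ ∩ Q)` on the finite configuration space. [folklore] -/
theorem toolGain_union_split (u : Sym2 (Fin n) → unitInterval) (P Q : Set (BondConfig (Fin n))) :
    (prodBernoulli u).real (P ∪ Q) = (prodBernoulli u).real P + (prodBernoulli u).real (Pᶜ ∩ Q) := by
  rw [← Set.sdiff_eq_compl_inter, ← measureReal_union (μ := prodBernoulli u) Set.disjoint_sdiff_right
    MeasurableSet.of_discrete, Set.union_sdiff_self]

/-- `μ(P) = μ(P ∩ Q) + μ(P ∩ Qᶜ)` on the finite configuration space. [folklore] -/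
theorem toolGain_inter_split (u : Sym2 (Fin n) → unitInterval) (P Q : Set (BondConfig (Fin n))) :
    (prodBernoulli u).real P = (prodBernoulli u).real (P ∩ Q) + (prodBernoulli u).real (P ∩ Qᶜ) := by
  rw [← Set.sdiff_eq, measureReal_inter_add_sdiff (μ := prodBernoulli u) (s := P)
    (MeasurableSet.of_discrete (s := Q))]

/-- **The gain event of the pair step, pointwise**: `{a₀↮b} ∩ ({a₀↔s} ∪ {a₀↔x}) ∩ ({s↔b} ∪ {x↔b})` is the union of
`{s↮b} ∩ {x↔b} ∩ {a₀↔s}` and `{s↔b} ∩ {a₀↮s} ∩ {x↔a₀}` (reachability algebra). [folklore; cf. KozmaNitzan2024 §3.2 p. 13] -/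
theorem toolGain_gain_eq (b a₀ s x : Fin n) :
    ((openConn a₀ b : Set (BondConfig (Fin n)))ᶜ ∩ (openConn a₀ s ∪ openConn a₀ x) ∩ (openConn s b ∪ openConn x b)) =
      ((openConn s b : Set (BondConfig (Fin n)))ᶜ ∩ openConn x b ∩ openConn a₀ s) ∪
        (openConn s b ∩ (openConn a₀ s)ᶜ ∩ openConn x a₀) := by
  ext ω
  simp only [Set.mem_union, Set.mem_inter_iff, Set.mem_compl_iff, toolGain_mem_openConn]
  constructor
  · rintro ⟨⟨hab, has | hax⟩, hSb⟩
    · -- `a₀ ↔ s`: then `s ↮ b`, hence `x ↔ b`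
      have hsb : ¬ (openGraph ω).Reachable s b := fun hsb => hab (has.trans hsb)
      rcases hSb with hsb' | hxb
      · exact absurd hsb' hsb
      · exact Or.inl ⟨⟨hsb, hxb⟩, has⟩
    · -- `a₀ ↔ x`: then `x ↮ b`, hence `s ↔ b`, and `a₀ ↮ s`
      rcases hSb with hsb | hxb
      · exact Or.inr ⟨⟨hsb, fun has => hab (has.trans hsb)⟩, hax.symm⟩
      · exact absurd (hax.trans hxb) hab
  · rintro (⟨⟨hsb, hxb⟩, has⟩ | ⟨⟨hsb, has⟩, hxa⟩)
    · exact ⟨⟨fun hab => hsb (has.symm.trans hab), Or.inl has⟩, Or.inr hxb⟩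
    · exact ⟨⟨fun hab => has (hab.trans hsb.symm), Or.inr hxa.symm⟩, Or.inl hsb⟩

/-- **The gain event of the pair step, in measure**: `μ(a₀↮b, a₀↔S, S↔b) = μ(s↮b, x↔b, a₀↔s) + μ(s↔b, a₀↮s, x↔a₀)`
for `S = {s, x}` (the two pieces are separated by `{s ↔ b}`). [folklore; cf. KozmaNitzan2024 §3.2 p. 13] -/
theorem toolGain_gain_measure (u : Sym2 (Fin n) → unitInterval) (b a₀ s x : Fin n) :
    (prodBernoulli u).real
        ((openConn a₀ b : Set (BondConfig (Fin n)))ᶜ ∩ (openConn a₀ s ∪ openConn a₀ x) ∩ (openConn s b ∪ openConn x b)) =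
      (prodBernoulli u).real ((openConn s b : Set (BondConfig (Fin n)))ᶜ ∩ openConn x b ∩ openConn a₀ s)
        + (prodBernoulli u).real (openConn s b ∩ (openConn a₀ s)ᶜ ∩ openConn x a₀ : Set (BondConfig (Fin n))) := by
  have hdisj : Disjoint ((openConn s b : Set (BondConfig (Fin n)))ᶜ ∩ openConn x b ∩ openConn a₀ s)
      (openConn s b ∩ (openConn a₀ s)ᶜ ∩ openConn x a₀ : Set (BondConfig (Fin n))) := by
    rw [Set.disjoint_left]
    rintro ω ⟨⟨hsb, -⟩, -⟩ ⟨⟨hsb', -⟩, -⟩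
    exact hsb hsb'
  rw [toolGain_gain_eq, measureReal_union (μ := prodBernoulli u) hdisj MeasurableSet.of_discrete]

/-- **TOOL (`stub_toolGainIdentity`): the gain identity of the pair step (bookkeeping).**
`μ(S↔b) − μ(s↔b) − μ(a₀↮b, a₀↔S, S↔b) = μ(s↮b, a₀↮s, x↔b) − μ(s↔b, a₀↮s, x↔a₀)` for `S = {s, x}`:
split `{S↔b} = {s↔b} ⊔ {s↮b, x↔b}`, split `{s↮b, x↔b}` along `{a₀↔s}`, and use `toolGain_gain_measure`.
(The relay set `A` and the side conditions are not used.) [cite: KozmaNitzan2024, §3.2 pp. 12–14] -/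
theorem stub_toolGainIdentity :
    ∀ (n : ℕ) (u : Sym2 (Fin n) → unitInterval) (A : Finset (Fin n)) (b a₀ s x : Fin n) (hb : b ∈ A),
      a₀ ∈ A → s ∉ A → x ∉ A → s ≠ x →
      (prodBernoulli u).real (⋃ v ∈ ({s, x} : Finset (Fin n)), openConn v b)
        - (prodBernoulli u).real (openConn s b)
        - (prodBernoulli u).real
              ((openConn a₀ b)ᶜ ∩ (⋃ v ∈ ({s, x} : Finset (Fin n)), openConn a₀ v) ∩ (⋃ v ∈ ({s, x} : Finset (Fin n)), openConn v b))
      = (prodBernoulli u).real ((openConn s b)ᶜ ∩ (openConn a₀ s)ᶜ ∩ openConn x b)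
        - (prodBernoulli u).real (openConn s b ∩ (openConn a₀ s)ᶜ ∩ openConn x a₀) := by
  intro n u _ b a₀ s x _ _ _ _ _
  simp only [Finset.set_biUnion_insert, Finset.set_biUnion_singleton]
  -- `μ(s↔b ∪ x↔b) = μ(s↔b) + μ(s↮b ∩ x↔b)`
  have h1 := toolGain_union_split u (openConn s b : Set (BondConfig (Fin n))) (openConn x b)
  -- `μ(s↮b ∩ x↔b) = μ(s↮b ∩ x↔b ∩ a₀↔s) + μ(s↮b ∩ x↔b ∩ a₀↮s)`
  have h2 := toolGain_inter_split u ((openConn s b : Set (BondConfig (Fin n)))ᶜ ∩ openConn x b) (openConn a₀ s)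
  -- the gain event
  have h3 := toolGain_gain_measure u b a₀ s x
  -- `{s↮b} ∩ {x↔b} ∩ {a₀↮s} = {s↮b} ∩ {a₀↮s} ∩ {x↔b}`
  have e : ((openConn s b : Set (BondConfig (Fin n)))ᶜ ∩ openConn x b ∩ (openConn a₀ s)ᶜ) =
      (openConn s b)ᶜ ∩ (openConn a₀ s)ᶜ ∩ openConn x b := by
    rw [Set.inter_assoc, Set.inter_comm (openConn x b : Set (BondConfig (Fin n))), ← Set.inter_assoc]
  rw [e] at h2
  rw [h1, h2, h3]
  ring

end ToolGainIdentity

end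

end Summit.CriticalPhenomena.PercolationContinuityZ3.Theorems
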